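import Literature.Barriers.CriticalPhenomena.PlaquetteWalkHoleRootHoleColumnClimb
import HarnessLib

/-!
# Barrier catalogue (SAWScalingLimit): in the HOLE COLUMN the straight level-`7` member CLOSES through the top row — straight up its climb column, or through the
HOOK KISS and up the prefix column («HOLE COLUMN: THE CLIMB TO THE TOP»)

`Z → ∞` limit model of the printed Yang–Baxter weights [GlazmanManolescu2019, §1, eq. (1)]; the «RECTANGLE COEFFICIENT» line (b-engine-1 g29), the frame of the
HOLE-COLUMN programme (FINDING-YB-HOLE-COLUMN-FOUR-PHASE; DESIGN-next b-engine-1 g28 §6 (a1)–(a3)). In the setting of `ΩG.rootRowClimb_of_cost_seven_straight_holeColumn_above`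
(the excursion pinned from the first hit, round the loop under the hole, across the root row and up the climb column `c₁` into the plaquette `g = (c₁, r.2)` of the row
of `r`, entered from `S` at the index `i₁`; `x₁ = w.1 + k₁ < c₁`):

* ★★★ `ΩG.topClimb_of_cost_seven_straight_holeColumn_above`: EITHER `g` is crossed STRAIGHT and the column `c₁` is climbed to the second top turn `t₂ = (c₁, Y)`; OR `g = e_E`
  is the east end of the horizontal chain of `r` (`ME = c₁ − r.1`), left through `W`, the row of `r` is followed west to the HOOK plaquette `h = (x₁, r.2)` — a kiss,
  entered from `E` and left through `N` — and the prefix column `x₁` is climbed to `t₂ = (x₁, Y)`. In both cases the top row is then followed WEST from `t₂` into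
  `T = (r.1, Y)`, ENTERED FROM THE EAST at the index `n − (Y − r.2)` of the final descent: the whole excursion is pinned and `n` is determined. (`g` cannot be left
  through `E`: it would be a kiss whose `N`-chain makes `(c₁, Y)` the second top turn while `e_E`, further east, would need a third; `h` cannot be crossed straight —
  the run would re-enter `r` — nor left downwards — the prefix column leads back into `p₁`.)

[GlazmanManolescu2019 §1 Fig. 1, eq. (1), Lemma 2.1, Remark 2.2; Glazman2015WeightedSAW Lemma 3.1 (proof, pp. 6–7); CourantRobbins1958 Ch. V App. §2 (the even–odd rule)]
-/

noncomputable section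

namespace Literature.Probability.RandomPlanarGeometry.SAW.YangBaxter

open Real
open Literature.Barriers.CriticalPhenomena.PlaquetteWalk

open private fc_fh fh_add_Mv three_le_Mv from Literature.Probability.RandomPlanarGeometry.YangBaxterSAWGeneralDomain
open private fc_sOut_pred_of_sIn_S fc_sOut_pred_of_sIn_N from Literature.Barriers.CriticalPhenomena.PlaquetteWalkStraightRuns
open private sIn_succ_eq_S sIn_succ_eq_N from Literature.Barriers.CriticalPhenomena.PlaquetteWalkKissChains

namespace ΩG

variable {D : Set Face} {w r : Face} {ω : ΩG D (w.side .W) r}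

/-- ★★★ **HOLE COLUMN: THE CLIMB TO THE TOP.** Let `ω` be a wound class-`B2a` walk of limit cost `7` from the hole root `w.side W` (hole `(w.1 − 1, w.2)` absent) with a
slanted end and a STRAIGHT first arc at a rhombus `r` of the hole column (`r.1 = w.1 − 1`) strictly above the hole, some arc of `ω` lying strictly above the row of `r`.
Then, with the data of `rootRowClimb_of_cost_seven_straight_holeColumn_above` (the excursion pinned into `g = (c₁, r.2)` entered from `S` at `i₁`; `x₁ = w.1 + k₁`) and
the column `c₂` of the second top turn (`t₂ = (c₂, Y)`): `T = (r.1, Y)` is entered from `E` and the plaquettes `(r.1 + m, Y)`, `m ≤ c₂ − r.1`, precede it in order; and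
EITHER `c₂ = c₁`, `g` is left through `N` and the plaquettes `(c₁, r.2 + m)`, `1 ≤ m ≤ Y − r.2`, follow `g` entered from `S`, the last being `t₂` at the index
`n − (Y − r.2) − (c₂ − r.1)`; OR `c₂ = x₁`, `ME = c₁ − r.1`, `g = e_E` is left through `W`, the plaquettes `(c₁ − m, r.2)`, `1 ≤ m ≤ c₁ − x₁`, follow entered from `E`, the
last — the hook plaquette `(x₁, r.2)` — is left through `N`, and the plaquettes `(x₁, r.2 + m)`, `1 ≤ m ≤ Y − r.2`, follow entered from `S`, the last being `t₂` at the
index `n − (Y − r.2) − (c₂ − r.1)`. [cite: GlazmanManolescu2019, §1, Fig. 1 and eq. (1); Lemma 2.1; Remark 2.2] [cite: Glazman2015WeightedSAW, Lemma 3.1 (proof, pp. 6–7)]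
[cite: CourantRobbins1958, Ch. V Appendix §2 (the even–odd rule)] -/
theorem topClimb_of_cost_seven_straight_holeColumn_above (hh : holeFaceW w ∉ D) (hr : RootedFace D (w.side .W) r) (h : ω.IsB2a)
    (hA : ω.AJ hr h (toC (midPt (w.side .W))) ≠ 0) (hc : cost (slotOfSide ω.1) ω.2.mids = 7) (hz : ω.1 = .N ∨ ω.1 = .S)
    (hstr8 : arcKind (ω.2.sIn ω.2.firstHitG) (ω.2.sOut ω.2.firstHitG) = .straight) (hcol : r.1 = w.1 - 1) (habove : w.2 < r.2)
    (hup : ∃ j < ω.2.arcs.length, r.2 < (ω.2.fc j).2) :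
    ∃ (c₂ : ℤ), ∃ (c₁ : ℤ), ∃ (Y Y' τ1 k₀ : ℤ) (MW ME k₁ : ℕ) (t₂ : Face),
      (∀ j < ω.2.arcs.length, (ω.2.fc j).2 ≤ Y) ∧ (∀ j < ω.2.arcs.length, Y' ≤ (ω.2.fc j).2) ∧ r.2 < Y ∧ Y' < w.2 ∧
      t₂.2 = Y ∧ t₂.1 ≠ r.1 ∧ w.1 ≤ τ1 ∧ 1 ≤ MW ∧ 1 ≤ ME ∧
      (∀ m : ℕ, 1 ≤ m → m ≤ MW → ω.2.UsesSide (r.1 - m, r.2) .E) ∧ (∀ m : ℕ, m < MW → ω.2.UsesSide (r.1 - m, r.2) .W) ∧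
        ¬ω.2.UsesSide (r.1 - MW, r.2) .W ∧
      (∀ m : ℕ, 1 ≤ m → m ≤ ME → ω.2.UsesSide (r.1 + m, r.2) .W) ∧ (∀ m : ℕ, m < ME → ω.2.UsesSide (r.1 + m, r.2) .E) ∧
        ¬ω.2.UsesSide (r.1 + ME, r.2) .E ∧
      (∀ f ∈ ({((r.1 : ℤ), Y), t₂, ((r.1 : ℤ) - MW, Y'), (k₀, Y'), ((τ1 : ℤ), w.2), ((r.1 : ℤ) - MW, r.2), ((r.1 : ℤ) + ME, r.2)} : Finset Face),
        f ∈ facesL ω.2.mids ∧ (kindsL ω.2.mids f = [.corner] ∨ kindsL ω.2.mids f = [.coCorner])) ∧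
      (∀ f : Face, f ∈ facesL ω.2.mids → (kindsL ω.2.mids f = [.corner] ∨ kindsL ω.2.mids f = [.coCorner]) →
        f ∈ ({((r.1 : ℤ), Y), t₂, ((r.1 : ℤ) - MW, Y'), (k₀, Y'), ((τ1 : ℤ), w.2), ((r.1 : ℤ) - MW, r.2), ((r.1 : ℤ) + ME, r.2)} : Finset Face)) ∧
      ω.1 = .N ∧ ω.2.fc (ω.2.arcs.length - 1) = (r.1, r.2 + 1) ∧ ω.2.sOut (ω.2.arcs.length - 1) = .S ∧
      (∀ m : ℕ, (m : ℤ) ≤ Y - r.2 - 1 → ω.2.fc (ω.2.arcs.length - 1 - m) = (r.1, r.2 + 1 + m)) ∧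
      (∀ m : ℕ, (m : ℤ) < Y - r.2 - 1 → ω.2.sIn (ω.2.arcs.length - 1 - m) = .N) ∧
      ω.2.UsesSide (r.1 - MW, r.2) .S ∧ ¬ω.2.UsesSide (r.1 - MW, r.2) .N ∧
      (∀ m : ℕ, 1 ≤ m → (m : ℤ) ≤ r.2 - Y' → ω.2.UsesSide (r.1 - MW, r.2 - m) .N) ∧
      (∀ m : ℕ, (m : ℤ) < r.2 - Y' → ω.2.UsesSide (r.1 - MW, r.2 - m) .S) ∧ ¬ω.2.UsesSide (r.1 - MW, Y') .S ∧
      -- new in this car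
      k₁ ≤ ω.2.firstHitG ∧ (∀ j < k₁, arcKind (ω.2.sIn j) (ω.2.sOut j) = .straight) ∧ arcKind (ω.2.sIn k₁) (ω.2.sOut k₁) ≠ .straight ∧
      ω.2.fc k₁ = (w.1 + k₁, w.2) ∧ ω.2.sIn k₁ = .W ∧ w.1 + k₁ ≤ k₀ ∧
      (∀ x : ℤ, ¬ω.2.UsesSide (x, Y') .S) ∧ ¬ω.2.UsesSide (r.1 - MW, Y') .W ∧ ¬ω.2.UsesSide (k₀, Y') .E ∧ ¬ω.2.UsesSide (k₀, Y') .S ∧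
      ω.2.sIn ω.2.firstHitG = .E ∧ ω.2.sOut ω.2.firstHitG = .W ∧
      (∀ m : ℕ, m ≤ MW → ω.2.fc (ω.2.firstHitG + m) = (r.1 - m, r.2) ∧ ω.2.sIn (ω.2.firstHitG + m) = .E) ∧
      (∀ m : ℕ, 1 ≤ m → (m : ℤ) ≤ r.2 - Y' → ω.2.fc (ω.2.firstHitG + MW + m) = (r.1 - MW, r.2 - m) ∧ ω.2.sIn (ω.2.firstHitG + MW + m) = .N) ∧
      (∀ m : ℕ, 1 ≤ m → (m : ℤ) ≤ k₀ - (r.1 - MW) →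
        ω.2.fc (ω.2.firstHitG + MW + (r.2 - Y').toNat + m) = (r.1 - MW + m, Y') ∧ ω.2.sIn (ω.2.firstHitG + MW + (r.2 - Y').toNat + m) = .W) ∧
      (∀ m : ℕ, 1 ≤ m → (m : ℤ) ≤ w.2 - Y' →
        ω.2.fc (ω.2.firstHitG + MW + (r.2 - Y').toNat + (k₀ - (r.1 - MW)).toNat + m) = (k₀, Y' + m) ∧
          ω.2.sIn (ω.2.firstHitG + MW + (r.2 - Y').toNat + (k₀ - (r.1 - MW)).toNat + m) = .S) ∧
      ω.2.firstHitG + MW + (r.2 - Y').toNat + (k₀ - (r.1 - MW)).toNat + (w.2 - Y').toNat < ω.2.arcs.length ∧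
      -- new in this car: the root-row passage and the climb to the row of `r`
      ((k₀ = w.1 + k₁ ∧ w.1 + k₁ < τ1 ∧ c₁ = τ1 ∧ ω.2.sOut k₁ = .N ∧
          ω.2.sOut (ω.2.firstHitG + MW + (r.2 - Y').toNat + (k₀ - (r.1 - MW)).toNat + (w.2 - Y').toNat) = .E ∧
          (∀ m : ℕ, 1 ≤ m → (m : ℤ) ≤ τ1 - (w.1 + k₁) →
            ω.2.fc (ω.2.firstHitG + MW + (r.2 - Y').toNat + (k₀ - (r.1 - MW)).toNat + (w.2 - Y').toNat + m) = (w.1 + k₁ + m, w.2) ∧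
            ω.2.sIn (ω.2.firstHitG + MW + (r.2 - Y').toNat + (k₀ - (r.1 - MW)).toNat + (w.2 - Y').toNat + m) = .W) ∧
          ω.2.sOut (ω.2.firstHitG + MW + (r.2 - Y').toNat + (k₀ - (r.1 - MW)).toNat + (w.2 - Y').toNat + (τ1 - (w.1 + k₁)).toNat) = .N) ∨
        (w.1 + k₁ < k₀ ∧ τ1 = w.1 + k₁ ∧ c₁ = k₀ ∧ ¬ω.2.UsesSide (w.1 + k₁, w.2) .S ∧ ¬ω.2.UsesSide (w.1 + k₁, w.2) .E ∧ ¬ω.2.UsesSide (k₀, w.2) .W ∧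
          ω.2.sOut (ω.2.firstHitG + MW + (r.2 - Y').toNat + (k₀ - (r.1 - MW)).toNat + (w.2 - Y').toNat) = .N)) ∧
      (∀ m : ℕ, 1 ≤ m → (m : ℤ) ≤ r.2 - w.2 →
        ω.2.fc (ω.2.firstHitG + MW + (r.2 - Y').toNat + (k₀ - (r.1 - MW)).toNat + (w.2 - Y').toNat + (c₁ - k₀).toNat + m) = (c₁, w.2 + m) ∧
          ω.2.sIn (ω.2.firstHitG + MW + (r.2 - Y').toNat + (k₀ - (r.1 - MW)).toNat + (w.2 - Y').toNat + (c₁ - k₀).toNat + m) = .S) ∧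
      ω.2.firstHitG + MW + (r.2 - Y').toNat + (k₀ - (r.1 - MW)).toNat + (w.2 - Y').toNat + (c₁ - k₀).toNat + (r.2 - w.2).toNat < ω.2.arcs.length ∧
      -- new in this car: the climb to the top row and the top row into `T`
      t₂ = (c₂, Y) ∧ ω.2.sIn (ω.2.arcs.length - 1 - (Y - r.2 - 1).toNat) = .E ∧ (c₂ - r.1).toNat ≤ ω.2.arcs.length - 1 - (Y - r.2 - 1).toNat ∧
      (∀ m : ℕ, (m : ℤ) ≤ c₂ - r.1 → ω.2.fc (ω.2.arcs.length - 1 - (Y - r.2 - 1).toNat - m) = (r.1 + m, Y)) ∧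
      (∀ m : ℕ, (m : ℤ) < c₂ - r.1 → ω.2.sIn (ω.2.arcs.length - 1 - (Y - r.2 - 1).toNat - m) = .E) ∧
      ((c₂ = c₁ ∧ ω.2.sOut (ω.2.firstHitG + MW + (r.2 - Y').toNat + (k₀ - (r.1 - MW)).toNat + (w.2 - Y').toNat + (c₁ - k₀).toNat + (r.2 - w.2).toNat) = .N ∧
          (∀ m : ℕ, 1 ≤ m → (m : ℤ) ≤ Y - r.2 → ω.2.fc (ω.2.firstHitG + MW + (r.2 - Y').toNat + (k₀ - (r.1 - MW)).toNat + (w.2 - Y').toNat + (c₁ - k₀).toNat + (r.2 - w.2).toNat + m) = (c₁, r.2 + m) ∧ ω.2.sIn (ω.2.firstHitG + MW + (r.2 - Y').toNat + (k₀ - (r.1 - MW)).toNat + (w.2 - Y').toNat + (c₁ - k₀).toNat + (r.2 - w.2).toNat + m) = .S) ∧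
          ω.2.firstHitG + MW + (r.2 - Y').toNat + (k₀ - (r.1 - MW)).toNat + (w.2 - Y').toNat + (c₁ - k₀).toNat + (r.2 - w.2).toNat + (Y - r.2).toNat = ω.2.arcs.length - 1 - (Y - r.2 - 1).toNat - (c₂ - r.1).toNat) ∨
        (c₂ = w.1 + k₁ ∧ (ME : ℤ) = c₁ - r.1 ∧ ω.2.sOut (ω.2.firstHitG + MW + (r.2 - Y').toNat + (k₀ - (r.1 - MW)).toNat + (w.2 - Y').toNat + (c₁ - k₀).toNat + (r.2 - w.2).toNat) = .W ∧
          (∀ m : ℕ, 1 ≤ m → (m : ℤ) ≤ c₁ - (w.1 + k₁) → ω.2.fc (ω.2.firstHitG + MW + (r.2 - Y').toNat + (k₀ - (r.1 - MW)).toNat + (w.2 - Y').toNat + (c₁ - k₀).toNat + (r.2 - w.2).toNat + m) = (c₁ - m, r.2) ∧ ω.2.sIn (ω.2.firstHitG + MW + (r.2 - Y').toNat + (k₀ - (r.1 - MW)).toNat + (w.2 - Y').toNat + (c₁ - k₀).toNat + (r.2 - w.2).toNat + m) = .E) ∧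
          ω.2.sOut (ω.2.firstHitG + MW + (r.2 - Y').toNat + (k₀ - (r.1 - MW)).toNat + (w.2 - Y').toNat + (c₁ - k₀).toNat + (r.2 - w.2).toNat + (c₁ - (w.1 + k₁)).toNat) = .N ∧
          (∀ m : ℕ, 1 ≤ m → (m : ℤ) ≤ Y - r.2 →
            ω.2.fc (ω.2.firstHitG + MW + (r.2 - Y').toNat + (k₀ - (r.1 - MW)).toNat + (w.2 - Y').toNat + (c₁ - k₀).toNat + (r.2 - w.2).toNat + (c₁ - (w.1 + k₁)).toNat + m) = (w.1 + k₁, r.2 + m) ∧ ω.2.sIn (ω.2.firstHitG + MW + (r.2 - Y').toNat + (k₀ - (r.1 - MW)).toNat + (w.2 - Y').toNat + (c₁ - k₀).toNat + (r.2 - w.2).toNat + (c₁ - (w.1 + k₁)).toNat + m) = .S) ∧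
          ω.2.firstHitG + MW + (r.2 - Y').toNat + (k₀ - (r.1 - MW)).toNat + (w.2 - Y').toNat + (c₁ - k₀).toNat + (r.2 - w.2).toNat + (c₁ - (w.1 + k₁)).toNat + (Y - r.2).toNat = ω.2.arcs.length - 1 - (Y - r.2 - 1).toNat - (c₂ - r.1).toNat)) := by
  classical
  set n := ω.2.arcs.length with hn
  ---------------------------------------------------------------- basics
  have hF := ω.fh_lt h
  have hlen : 0 < n := by omega
  have h0w : ω.2.fc 0 = w := fc_zero_eq_root w hh ω.2 hlen
  have h0W : ω.2.sIn 0 = .W := YBWalk.sIn_zero_eq_W hh ω.2 hlen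
  have h0E : ω.2.sIn 0 ≠ .E := by rw [h0W]; decide
  have h0N : ω.2.sIn 0 ≠ .N := by rw [h0W]; decide
  have h0S : ω.2.sIn 0 ≠ .S := by rw [h0W]; decide
  have hfcF := (fc_fh ω hr h).1
  have hsvr : ∀ l < n, ω.2.fc l = ω.2.fc ω.2.firstHitG → l = ω.2.firstHitG := fun l hl e => eq_firstHitG_of_fc_eq hr h hl e
  have hn1 : n - 1 < n := by omega
  have hwr : r.1 < w.1 := by omega
  ---------------------------------------------------------------- the root-row climb (car 43) with the seven turns
  obtain ⟨c₁, Y, Y', τ1, k₀, MW, ME, k₁, t₂, hY, hY', hr₃, hY'w, ht₂row, ht₂col, hτ1w, hMW1, hME1, hEW, hWW, hnotW, hWE, hEE, hnotE,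
    hseven, hall, hN1, hL, hLS, hdesc, hdescIn, heWS, heWnN, hlegN, hlegS, hbWnS, hk₁F, hstr, hk₁ns, hfk, hWk, hk₀w, hbotS, hbWnW, hbEnE, hbEnS,
    hinF, houtF, hrunR, hrunL, hrunB, hrunE, hi₀n, hpass, hclimb, hi₁n⟩ :=
    rootRowClimb_of_cost_seven_straight_holeColumn_above hh hr h hA hc hz hstr8 hcol habove hup
  let P : Face → Prop := fun f => f ∈ facesL ω.2.mids ∧ (kindsL ω.2.mids f = [.corner] ∨ kindsL ω.2.mids f = [.coCorner])
  have hPiso : ∀ k < n, (∀ l < n, ω.2.fc l = ω.2.fc k → l = k) → arcKind (ω.2.sIn k) (ω.2.sOut k) ≠ .straight → P (ω.2.fc k) :=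
    fun k hk hsv hkind => isolated_turn hk hsv hkind
  have hmem7 : ∀ f : Face, P f → f = ((r.1 : ℤ), Y) ∨ f = t₂ ∨ f = ((r.1 : ℤ) - MW, Y') ∨ f = (k₀, Y') ∨ f = ((τ1 : ℤ), w.2) ∨
      f = ((r.1 : ℤ) - MW, r.2) ∨ f = ((r.1 : ℤ) + ME, r.2) := by
    intro f hPf
    have := hall f hPf.1 hPf.2
    simpa only [Finset.mem_insert, Finset.mem_singleton] using this
  have hP7 : ∀ f : Face, (f = ((r.1 : ℤ), Y) ∨ f = t₂ ∨ f = ((r.1 : ℤ) - MW, Y') ∨ f = (k₀, Y') ∨ f = ((τ1 : ℤ), w.2) ∨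
      f = ((r.1 : ℤ) - MW, r.2) ∨ f = ((r.1 : ℤ) + ME, r.2)) → P f := by
    intro f hf
    apply hseven
    simpa only [Finset.mem_insert, Finset.mem_singleton] using hf
  have hProw : ∀ f : Face, P f → f.2 = Y ∨ f.2 = Y' ∨ f.2 = w.2 ∨ f.2 = r.2 := by
    intro f hPf
    rcases hmem7 f hPf with rfl | rfl | rfl | rfl | rfl | rfl | rfl
    · exact Or.inl rfl
    · exact Or.inl ht₂row
    · exact Or.inr (Or.inl rfl)
    · exact Or.inr (Or.inl rfl)
    · exact Or.inr (Or.inr (Or.inl rfl))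
    · exact Or.inr (Or.inr (Or.inr rfl))
    · exact Or.inr (Or.inr (Or.inr rfl))
  have hbots : ∀ f : Face, P f → f.2 = Y' → f = ((r.1 : ℤ) - MW, Y') ∨ f = (k₀, Y') := by
    intro f hPf hfY
    rcases hmem7 f hPf with e | e | e | e | e | e | e
    · exfalso; rw [e] at hfY; simp only at hfY; omega
    · exfalso; rw [e, ht₂row] at hfY; omega
    · exact Or.inl e
    · exact Or.inr e
    · exfalso; rw [e] at hfY; simp only at hfY; omega
    · exfalso; rw [e] at hfY; simp only at hfY; omega
    · exfalso; rw [e] at hfY; simp only at hfY; omega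
  obtain ⟨X', -, hX', -⟩ := exists_right_entry_turn hh hr h
  obtain ⟨X, hXw, hX, -⟩ := exists_left_entry_turn hh hr h hA
  ---------------------------------------------------------------- rows: a plaquette using `E` or `W` lies on one of the four turn rows
  have hrowE : ∀ c : Face, ω.2.UsesSide c .E → c.2 = Y ∨ c.2 = Y' ∨ c.2 = w.2 ∨ c.2 = r.2 := by
    intro c hcE
    obtain ⟨M, hWall, -, hend⟩ := ω.2.chain_E hX' hcE
    rcases hend with ⟨hM1, hnot⟩ | ⟨-, hs0⟩ | ⟨-, hsZ⟩
    · obtain ⟨i', hi', hfc', hsv', -, -, -, hk'⟩ := ω.2.isolated_of_usesSide_not_opp (hWall M hM1 le_rfl) hnot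
      have hP' : P (c.1 + M, c.2) := by rw [← hfc']; exact hPiso i' hi' hsv' hk'
      have := hProw _ hP'; simp only at this; exact this
    · exact absurd hs0 h0E
    · rw [hLS] at hsZ; exact absurd hsZ (by decide)
  have hrowW : ∀ c : Face, ω.2.UsesSide c .W → c.2 = Y ∨ c.2 = Y' ∨ c.2 = w.2 ∨ c.2 = r.2 := by
    intro c hcW
    obtain ⟨M, hEall, -, hend⟩ := ω.2.chain_W hX hcW
    rcases hend with ⟨hM1, hnot⟩ | ⟨hA0, -⟩ | ⟨-, hsZ⟩
    · obtain ⟨i', hi', hfc', hsv', -, -, -, hk'⟩ := ω.2.isolated_of_usesSide_not_opp (hEall M hM1 le_rfl) hnot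
      have hP' : P (c.1 - M, c.2) := by rw [← hfc']; exact hPiso i' hi' hsv' hk'
      have := hProw _ hP'; simp only at this; exact this
    · rw [h0w] at hA0; have := congrArg Prod.snd hA0; simp only at this; exact Or.inr (Or.inr (Or.inl this))
    · rw [hLS] at hsZ; exact absurd hsZ (by decide)
  have hvert : ∀ i < n, (ω.2.fc i).2 ≠ Y → (ω.2.fc i).2 ≠ Y' → (ω.2.fc i).2 ≠ w.2 → (ω.2.fc i).2 ≠ r.2 →
      arcKind (ω.2.sIn i) (ω.2.sOut i) = .straight := by
    intro i hi h1 h2 h3 h4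
    have hnot : ¬(ω.2.UsesSide (ω.2.fc i) .E ∨ ω.2.UsesSide (ω.2.fc i) .W) := by
      rintro (hu | hu)
      · rcases hrowE _ hu with e | e | e | e
        · exact h1 e
        · exact h2 e
        · exact h3 e
        · exact h4 e
      · rcases hrowW _ hu with e | e | e | e
        · exact h1 e
        · exact h2 e
        · exact h3 e
        · exact h4 e
    have hiE : ω.2.sIn i ≠ .E := fun e => hnot (Or.inl ⟨i, hi, rfl, Or.inl e⟩)
    have hoE : ω.2.sOut i ≠ .E := fun e => hnot (Or.inl ⟨i, hi, rfl, Or.inr e⟩)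
    have hiW : ω.2.sIn i ≠ .W := fun e => hnot (Or.inr ⟨i, hi, rfl, Or.inl e⟩)
    have hoW : ω.2.sOut i ≠ .W := fun e => hnot (Or.inr ⟨i, hi, rfl, Or.inr e⟩)
    have hne := ω.2.sIn_ne_sOut hi
    revert hiE hoE hiW hoW hne
    cases ω.2.sIn i <;> cases ω.2.sOut i <;> decide
  ---------------------------------------------------------------- abbreviations for the pinned indices
  obtain ⟨dB, hdB⟩ : ∃ dB : ℕ, (dB : ℤ) = w.2 - Y' - 1 := ⟨(w.2 - Y' - 1).toNat, by omega⟩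
  obtain ⟨dR, hdR⟩ : ∃ dR : ℕ, (dR : ℤ) = k₀ - (r.1 - MW) - 1 := ⟨(k₀ - (r.1 - MW) - 1).toNat, by omega⟩
  obtain ⟨dL, hdL⟩ : ∃ dL : ℕ, (dL : ℤ) = r.2 - Y' - 1 := ⟨(r.2 - Y' - 1).toNat, by omega⟩
  obtain ⟨dM, hdM⟩ : ∃ dM : ℕ, (dM : ℤ) = r.2 - w.2 - 1 := ⟨(r.2 - w.2 - 1).toNat, by omega⟩
  obtain ⟨dT, hdT⟩ : ∃ dT : ℕ, (dT : ℤ) = Y - r.2 - 1 := ⟨(Y - r.2 - 1).toNat, by omega⟩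
  have htoNat : ∀ (a : ℤ) (k : ℕ), a = k → a.toNat = k := fun a k e => by subst e; exact Int.toNat_natCast k
  set x₁ : ℤ := w.1 + k₁ with hx₁def
  have hc₁x : x₁ < c₁ := by rcases hpass with ⟨e1, e2, e3, -⟩ | ⟨e1, -, e3, -⟩ <;> omega
  obtain ⟨dC, hdC⟩ : ∃ dC : ℕ, (dC : ℤ) = c₁ - k₀ := ⟨(c₁ - k₀).toNat, by rcases hpass with ⟨e1, e2, e3, -⟩ | ⟨e1, -, e3, -⟩ <;> omega⟩
  rw [htoNat (r.2 - Y') (dL + 1) (by push_cast; omega), htoNat (k₀ - (r.1 - MW)) (dR + 1) (by push_cast; omega),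
    htoNat (w.2 - Y') (dB + 1) (by push_cast; omega), htoNat (c₁ - k₀) dC (by omega), htoNat (r.2 - w.2) (dM + 1) (by push_cast; omega)] at hi₁n
  rw [htoNat (r.2 - Y') (dL + 1) (by push_cast; omega), htoNat (k₀ - (r.1 - MW)) (dR + 1) (by push_cast; omega),
    htoNat (w.2 - Y') (dB + 1) (by push_cast; omega), htoNat (c₁ - k₀) dC (by omega)] at hclimb
  obtain ⟨i₁', hi₁'def⟩ : ∃ i₁' : ℕ, ω.2.firstHitG + MW + (dL + 1) + (dR + 1) + (dB + 1) + dC = i₁' := ⟨_, rfl⟩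
  rw [hi₁'def] at hi₁n hclimb
  obtain ⟨hfcg, hing⟩ := hclimb (dM + 1) (by omega) (by omega)
  obtain ⟨i₁, hi₁def⟩ : ∃ i₁ : ℕ, i₁' + (dM + 1) = i₁ := ⟨_, rfl⟩
  rw [hi₁def] at hi₁n hfcg hing
  have hfcg' : ω.2.fc i₁ = (c₁, r.2) := by rw [hfcg]; exact Prod.ext rfl (by push_cast; omega)
  ---------------------------------------------------------------- plaquettes of the row of `r` using `S`; the top `T` of the descent
  have hr2S : ∀ x : ℤ, ω.2.UsesSide (x, r.2) .S → x = r.1 - MW ∨ x = x₁ ∨ x = c₁ := by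
    intro x hu
    obtain ⟨M, hNall, -, hend⟩ := ω.2.chain_S hY' hu
    simp only at hNall hend
    rcases hend with ⟨hM1, hnot⟩ | ⟨-, hs0⟩ | ⟨hZ, -⟩
    · obtain ⟨i', hi', hfc', hsv', -, -, -, hk'⟩ := ω.2.isolated_of_usesSide_not_opp (hNall M hM1 le_rfl) hnot
      have hP' : P (x, r.2 - M) := by rw [← hfc']; exact hPiso i' hi' hsv' hk'
      rcases hmem7 _ hP' with e | e | e | e | e | e | e
      · have := congrArg Prod.snd e; simp only at this; omega
      · have := congrArg Prod.snd e; rw [ht₂row] at this; simp only at this; omega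
      · have := congrArg Prod.fst e; simp only at this; exact Or.inl this
      · have := congrArg Prod.fst e; simp only at this
        rcases hpass with ⟨e1, -, e3, -⟩ | ⟨-, -, e3, -⟩
        · exact Or.inr (Or.inl (by omega))
        · exact Or.inr (Or.inr (by omega))
      · have := congrArg Prod.fst e; simp only at this
        rcases hpass with ⟨-, -, e3, -⟩ | ⟨-, e2, -, -⟩
        · exact Or.inr (Or.inr (by omega))
        · exact Or.inr (Or.inl (by omega))
      · have := congrArg Prod.snd e; simp only at this; omega
      · have := congrArg Prod.snd e; simp only at this; omega
    · exact absurd hs0 h0S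
    · rw [hL] at hZ; have := congrArg Prod.snd hZ; simp only at this; omega
  have hNtop := forall_top_ne_N hh hr h hY (by omega)
  have hjTn : n - 1 - dT < n := by omega
  have hfcT : ω.2.fc (n - 1 - dT) = (r.1, Y) := by rw [hdesc dT (by omega)]; exact Prod.ext rfl (by simp only; omega)
  have hjT1 : 1 ≤ n - 1 - dT := by
    by_contra hlt
    have e0 : n - 1 - dT = 0 := by omega
    have e := hfcT
    rw [e0, h0w] at e
    have := congrArg Prod.fst e; simp only at this; omega
  have hTS : ω.2.sOut (n - 1 - dT) = .S := by
    rcases Nat.eq_zero_or_pos dT with h0 | hpos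
    · rw [h0, Nat.sub_zero]; exact hLS
    · have hlt : ((dT - 1 : ℕ) : ℤ) < Y - r.2 - 1 := by
        rw [Nat.cast_sub (by omega : 1 ≤ dT)]; push_cast; omega
      have hin := hdescIn (dT - 1) hlt
      have := (fc_sOut_pred_of_sIn_N ω.2 (i := n - 1 - (dT - 1)) (by omega) (by omega) hin).2
      rwa [show n - 1 - (dT - 1) - 1 = n - 1 - dT by omega] at this
  have htops : ∀ f : Face, P f → f.2 = Y → f = ((r.1 : ℤ), Y) ∨ f = t₂ := by
    intro f hPf hfY
    rcases hmem7 f hPf with e | e | e | e | e | e | e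
    · exact Or.inl e
    · exact Or.inr e
    · exfalso; rw [e] at hfY; simp only at hfY; omega
    · exfalso; rw [e] at hfY; simp only at hfY; omega
    · exfalso; rw [e] at hfY; simp only at hfY; omega
    · exfalso; rw [e] at hfY; simp only at hfY; omega
    · exfalso; rw [e] at hfY; simp only at hfY; omega
  -- `T` is entered from `E` as soon as the other top turn lies east of the hole column
  have hTin_of : r.1 < t₂.1 → ω.2.sIn (n - 1 - dT) = .E := by
    intro ht
    have h1 := (hNtop _ hjTn (by rw [hfcT])).1
    have hne := ω.2.sIn_ne_sOut hjTn
    rw [hTS] at hne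
    have hnW : ω.2.sIn (n - 1 - dT) ≠ .W := by
      intro hW
      obtain ⟨M', hEall, -, hend'⟩ := ω.2.chain_W hX ⟨_, hjTn, hfcT, Or.inl hW⟩
      simp only at hEall hend'
      rcases hend' with ⟨hM1, hnot⟩ | ⟨hA0, -⟩ | ⟨-, hsZ⟩
      · obtain ⟨i', hi', hfc', hsv', -, -, -, hk'⟩ := ω.2.isolated_of_usesSide_not_opp (hEall M' hM1 le_rfl) hnot
        have hP' : P ((r.1 : ℤ) - M', Y) := by rw [← hfc']; exact hPiso i' hi' hsv' hk'
        rcases htops _ hP' rfl with e | e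
        · have := congrArg Prod.fst e; simp only at this; omega
        · have := congrArg Prod.fst e; rw [← e] at ht; simp only at ht; omega
      · rw [h0w] at hA0; have := congrArg Prod.snd hA0; simp only at this; omega
      · rw [hLS] at hsZ; exact absurd hsZ (by decide)
    revert h1 hne hnW; cases ω.2.sIn (n - 1 - dT) <;> decide
  -- the top row read backwards from `T` out to a top turn `(c, Y)` east of `T`
  have htoprun : ∀ c : ℤ, t₂ = (c, Y) → r.1 < c →
      ω.2.sIn (n - 1 - dT) = .E ∧ (c - r.1).toNat ≤ n - 1 - dT ∧
      (∀ m : ℕ, (m : ℤ) ≤ c - r.1 → ω.2.fc (n - 1 - dT - m) = (r.1 + m, Y)) ∧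
      (∀ m : ℕ, (m : ℤ) < c - r.1 → ω.2.sIn (n - 1 - dT - m) = .E) ∧ ¬ω.2.UsesSide (c, Y) .E := by
    intro c ht₂ hc
    have hTin := hTin_of (by rw [ht₂]; exact hc)
    obtain ⟨M₂, hW2, hE2, hend2⟩ := ω.2.chain_E hX' ⟨_, hjTn, hfcT, Or.inl hTin⟩
    simp only at hW2 hE2 hend2
    obtain ⟨hM₂, htnE⟩ : (M₂ : ℤ) = c - r.1 ∧ ¬ω.2.UsesSide (c, Y) .E := by
      rcases hend2 with ⟨hM1, hnot⟩ | ⟨-, hs0⟩ | ⟨-, hsZ⟩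
      · obtain ⟨i', hi', hfc', hsv', -, -, -, hk'⟩ := ω.2.isolated_of_usesSide_not_opp (hW2 M₂ hM1 le_rfl) hnot
        have hP' : P ((r.1 : ℤ) + M₂, Y) := by rw [← hfc']; exact hPiso i' hi' hsv' hk'
        rcases htops _ hP' rfl with e | e
        · have := congrArg Prod.fst e; simp only at this; omega
        · rw [ht₂] at e; have := congrArg Prod.fst e; simp only at this
          refine ⟨by omega, ?_⟩
          rw [show ((c, Y) : Face) = ((r.1 : ℤ) + M₂, Y) from Prod.ext (by simp only; omega) rfl]; exact hnot
      · exact absurd hs0 h0E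
      · rw [hLS] at hsZ; exact absurd hsZ (by decide)
    have htopStraight : ∀ m : ℕ, 1 ≤ m → m ≤ M₂ - 1 → ∀ l < n, ω.2.fc l = ((ω.2.fc (n - 1 - dT)).1 + m, (ω.2.fc (n - 1 - dT)).2) →
        arcKind (ω.2.sIn l) (ω.2.sOut l) = .straight := by
      intro m hm1 hmM l hl hfl
      rw [hfcT] at hfl; simp only at hfl
      have hnN : ¬ω.2.UsesSide ((r.1 : ℤ) + m, Y) .N := by
        rintro ⟨j, hj, hfj, hs⟩
        have := hNtop j hj (by rw [hfj])
        rcases hs with hs | hs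
        · exact this.1 hs
        · exact this.2 hs
      exact ω.2.straight_of_usesSide_EW (hE2 m (by omega)) (hW2 m hm1 (by omega)) hnN l hl hfl
    have hMT : M₂ - 1 ≤ n - 1 - dT := by
      by_contra hlt
      push Not at hlt
      obtain ⟨hfc0, -⟩ := ω.2.run_back_east_of_straight hjTn le_rfl hTin
        (fun m hm1 hmM l hl hfl => htopStraight m hm1 (by omega) l hl hfl) (n - 1 - dT) le_rfl
      rw [Nat.sub_self, h0w, hfcT] at hfc0
      have := congrArg Prod.snd hfc0; simp only at this; omega
    have hrunT := ω.2.run_back_east_of_straight hjTn hMT hTin htopStraight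
    obtain ⟨hfcT1, hinT1⟩ := hrunT (M₂ - 1) le_rfl
    rw [hfcT] at hfcT1; simp only at hfcT1
    have hj1 : 1 ≤ n - 1 - dT - (M₂ - 1) := by
      by_contra hlt
      have e0 : n - 1 - dT - (M₂ - 1) = 0 := by omega
      rw [e0, h0w] at hfcT1
      have := congrArg Prod.snd hfcT1; simp only at this; omega
    obtain ⟨hfct, -⟩ := ω.2.fc_pred_eq_of_sIn_E (by omega) hj1 hinT1
    rw [hfcT1, show n - 1 - dT - (M₂ - 1) - 1 = n - 1 - dT - M₂ by omega] at hfct; simp only at hfct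
    refine ⟨hTin, by omega, fun m hm => ?_, fun m hm => ?_, htnE⟩
    · rcases Nat.lt_or_ge m M₂ with hlt | hge
      · obtain ⟨e, -⟩ := hrunT m (by omega); rw [e, hfcT]
      · have em : m = M₂ := by omega
        subst em
        rw [hfct]; exact Prod.ext (by simp only; push_cast [Nat.cast_sub (show 1 ≤ m by omega)]; ring) rfl
    · exact (hrunT m (by omega)).2
  -- a column climbed straight from the row of `r` ends at the top turn `t₂`
  have hcolStraight : ∀ (c : ℤ) (m : ℕ), 1 ≤ m → m ≤ dT → ∀ l < n, ω.2.fc l = (c, r.2 + m) → arcKind (ω.2.sIn l) (ω.2.sOut l) = .straight := by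
    intro c m hm1 hmM l hl hfl
    exact hvert l hl (by rw [hfl]; simp only; omega) (by rw [hfl]; simp only; omega) (by rw [hfl]; simp only; omega) (by rw [hfl]; simp only; omega)
  have hup_to_top : ∀ (c : ℤ) (j : ℕ), j < n → ω.2.fc j = (c, r.2) → ω.2.sOut j = .N → r.1 < c →
      t₂ = (c, Y) ∧ (∀ m : ℕ, 1 ≤ m → (m : ℤ) ≤ Y - r.2 → ω.2.fc (j + m) = (c, r.2 + m) ∧ ω.2.sIn (j + m) = .S) ∧
        j + (dT + 1) = n - 1 - dT - (c - r.1).toNat := by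
    intro c j hj hfcj houtj hc
    have hcells : ∀ m : ℕ, 1 ≤ m → m ≤ dT → ∀ l < n, ω.2.fc l = ((ω.2.fc j).1, (ω.2.fc j).2 + m) → arcKind (ω.2.sIn l) (ω.2.sOut l) = .straight := by
      intro m hm1 hmM l hl hfl
      rw [hfcj] at hfl; exact hcolStraight c m hm1 hmM l hl hfl
    have hjM : j + dT + 1 < n := by
      by_contra hge
      obtain ⟨e, -⟩ := ω.2.run_up_of_straight (j := j) (M := n - 1 - j) (by omega) houtj (fun m hm1 hmM l hl hfl => hcells m hm1 (by omega) l hl hfl)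
        (n - 1 - j) le_rfl
      rw [show j + (n - 1 - j) = n - 1 by omega, hL, hfcj] at e
      have := congrArg Prod.fst e; simp only at this; omega
    have hrunU := ω.2.run_up_of_straight (j := j) (M := dT) (by omega) houtj hcells
    obtain ⟨hfcD, houtD⟩ := hrunU dT le_rfl
    rw [hfcj] at hfcD
    have hfct := ω.2.fc_succ_eq_of_sOut_N hjM houtD
    have hint := sIn_succ_eq_S ω.2 hjM houtD
    rw [hfcD] at hfct; simp only at hfct
    have hfct' : ω.2.fc (j + dT + 1) = (c, Y) := by rw [hfct]; exact Prod.ext rfl (by simp only; omega)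
    -- the top cell is a turn (not `N`), singly visited: a top P-cell, hence `t₂`
    have htnN : ¬ω.2.UsesSide (c, Y) .N := by
      rintro ⟨l, hl, hfl, hs⟩
      have := hNtop l hl (by rw [hfl])
      rcases hs with hs | hs
      · exact this.1 hs
      · exact this.2 hs
    have hsvt : ∀ l < n, ω.2.fc l = ω.2.fc (j + dT + 1) → l = j + dT + 1 :=
      fun l hl e => ω.2.single_visit_of_not_usesSide htnN hl hjM (e.trans hfct') hfct'
    have htk : arcKind (ω.2.sIn (j + dT + 1)) (ω.2.sOut (j + dT + 1)) ≠ .straight := by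
      have h2 := (hNtop _ hjM (by rw [hfct'])).2
      rw [hint]; revert h2; cases ω.2.sOut (j + dT + 1) <;> decide
    have hPt : P (c, Y) := by rw [← hfct']; exact hPiso _ hjM hsvt htk
    have ht₂ : t₂ = (c, Y) := by
      rcases htops _ hPt rfl with e | e
      · have := congrArg Prod.fst e; simp only at this; omega
      · exact e.symm
    -- it is left through `W`, and the top row leads into `T`
    obtain ⟨hTin, hMT, hrunT, hrunTin, htnE⟩ := htoprun c ht₂ hc
    have houtt : ω.2.sOut (j + dT + 1) = .W := by
      have hne := ω.2.sIn_ne_sOut hjM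
      rw [hint] at hne
      have h2 := (hNtop _ hjM (by rw [hfct'])).2
      have hnE : ω.2.sOut (j + dT + 1) ≠ .E := fun e => htnE ⟨_, hjM, hfct', Or.inr e⟩
      revert hne h2 hnE; cases ω.2.sOut (j + dT + 1) <;> decide
    -- the top turn read from `T`'s side: the same plaquette, hence the same index
    obtain ⟨m₂, hm₂⟩ : ∃ m₂ : ℕ, (m₂ : ℤ) = c - r.1 := ⟨(c - r.1).toNat, by omega⟩
    have e₂ := hrunT m₂ (by omega)
    have hidx : n - 1 - dT - m₂ = j + dT + 1 := hsvt _ (by omega) (by rw [e₂, hfct']; exact Prod.ext (by simp only; omega) rfl)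
    refine ⟨ht₂, fun m hm1 hmM => ?_, by rw [show (c - r.1).toNat = m₂ by omega]; omega⟩
    rcases Nat.lt_or_ge dT m with hbig | hsmall
    · have em : m = dT + 1 := by omega
      subst em
      rw [show j + (dT + 1) = j + dT + 1 by omega]
      exact ⟨by rw [hfct']; exact Prod.ext rfl (by push_cast; omega), hint⟩
    · rcases Nat.eq_zero_or_pos m with h0 | hpos
      · omega
      obtain ⟨hfcD', houtD'⟩ := hrunU (m - 1) (by omega)
      rw [hfcj] at hfcD'
      have hjm : j + (m - 1) + 1 < n := by omega
      have e1 := ω.2.fc_succ_eq_of_sOut_N hjm houtD'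
      have e3 := sIn_succ_eq_S ω.2 hjm houtD'
      rw [hfcD'] at e1; simp only at e1
      rw [show j + (m - 1) + 1 = j + m by omega] at e1 e3
      exact ⟨by rw [e1]; exact Prod.ext rfl (by push_cast [Nat.cast_sub hpos]; ring), e3⟩
  ---------------------------------------------------------------- the three exits of `g = (c₁, r.2)`
  -- `g` left through `E` is impossible; `g` using `N` together with `E` or `W`… we organise by the exit side
  have houtg : ω.2.sOut i₁ = .N ∨ ω.2.sOut i₁ = .W := by
    have hne := ω.2.sIn_ne_sOut hi₁n
    rw [hing] at hne
    have hnE : ω.2.sOut i₁ ≠ .E := by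
      intro hE
      have hgE : ω.2.UsesSide (c₁, r.2) .E := ⟨_, hi₁n, hfcg', Or.inr hE⟩
      -- `g` is not singly visited (it would be the isolated turn `e_E`, which does not use `E`)
      have hgN : ω.2.UsesSide (c₁, r.2) .N := by
        by_contra hnN
        have hsvg : ∀ l < n, ω.2.fc l = ω.2.fc i₁ → l = i₁ :=
          fun l hl e => ω.2.single_visit_of_not_usesSide hnN hl hi₁n (e.trans hfcg') hfcg'
        have hPg : P (c₁, r.2) := by rw [← hfcg']; exact hPiso _ hi₁n hsvg (by rw [hing, hE]; decide)
        rcases hmem7 _ hPg with e | e | e | e | e | e | e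
        · have := congrArg Prod.snd e; simp only at this; omega
        · have := congrArg Prod.snd e; rw [ht₂row] at this; simp only at this; omega
        · have := congrArg Prod.snd e; simp only at this; omega
        · have := congrArg Prod.snd e; simp only at this; omega
        · have := congrArg Prod.snd e; simp only at this; omega
        · have := congrArg Prod.fst e; simp only at this; omega
        · have e' := e
          rw [e'] at hgE; exact hnotE hgE
      -- its `N`-chain makes `(c₁, Y)` the second top turn
      obtain ⟨M, hSall, -, hend⟩ := ω.2.chain_N hY hgN
      simp only at hSall hend
      have ht₂c : t₂ = (c₁, Y) := by
        rcases hend with ⟨hM1, hnot⟩ | ⟨-, hs0⟩ | ⟨hZ, -⟩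
        · obtain ⟨i', hi', hfc', hsv', -, -, -, hk'⟩ := ω.2.isolated_of_usesSide_not_opp (hSall M hM1 le_rfl) hnot
          have hP' : P (c₁, r.2 + M) := by rw [← hfc']; exact hPiso i' hi' hsv' hk'
          have hrow' : (((c₁, r.2 + M) : Face)).2 = Y := by
            rcases hProw _ hP' with e | e | e | e <;> simp only at e ⊢ <;> omega
          rcases htops _ hP' hrow' with e | e
          · have := congrArg Prod.fst e; simp only at this; omega
          · simp only at hrow'; rw [← e]; exact Prod.ext rfl (by simp only; omega)
        · exact absurd hs0 h0N
        · rw [hL] at hZ; have := congrArg Prod.fst hZ; simp only at this; omega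
      -- `e_E` lies strictly east of `g`
      have hxE : c₁ < r.1 + ME := by
        by_contra hle
        push Not at hle
        rcases lt_or_eq_of_le hle with hlt' | heq'
        · -- `e_E` strictly between `r` and `g`: the `W`-chain of `g` cannot end
          have hgW : ω.2.UsesSide (c₁, r.2) .W := by
            obtain ⟨l, hl, hfl, hsN⟩ := hgN
            have hli : l ≠ i₁ := by
              intro e
              rw [e] at hsN
              have hne2 := ω.2.sIn_ne_sOut hi₁n
              revert hsN hing hE hne2; cases ω.2.sIn i₁ <;> cases ω.2.sOut i₁ <;> decide
            exact hfl ▸ ω.2.usesSide_of_fc_eq hl hi₁n hli (hfl.trans hfcg'.symm) .W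
          obtain ⟨M', hEall, -, hend'⟩ := ω.2.chain_W hX hgW
          simp only at hEall hend'
          rcases hend' with ⟨hM1, hnot⟩ | ⟨hA0, -⟩ | ⟨-, hsZ⟩
          · obtain ⟨i', hi', hfc', hsv', -, -, -, hk'⟩ := ω.2.isolated_of_usesSide_not_opp (hEall M' hM1 le_rfl) hnot
            have hP' : P (c₁ - M', r.2) := by rw [← hfc']; exact hPiso i' hi' hsv' hk'
            rcases hmem7 _ hP' with e | e | e | e | e | e | e
            · have := congrArg Prod.snd e; simp only at this; omega
            · rw [ht₂c] at e; have := congrArg Prod.snd e; simp only at this; omega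
            · have := congrArg Prod.snd e; simp only at this; omega
            · have := congrArg Prod.snd e; simp only at this; omega
            · have := congrArg Prod.snd e; simp only at this; omega
            · have ex := congrArg Prod.fst e; simp only at ex
              obtain ⟨mm, hmm⟩ : ∃ mm : ℕ, (mm : ℤ) = c₁ - (r.1 + ME) := ⟨(c₁ - (r.1 + ME)).toNat, by omega⟩
              have := hEall mm (by omega) (by omega)
              rw [show ((c₁ - (mm : ℤ), r.2) : Face) = ((r.1 : ℤ) + ME, r.2) from Prod.ext (by simp only; omega) rfl] at this
              exact hnotE this
            · have ex := congrArg Prod.fst e; simp only at ex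
              apply hnot
              rw [show ((c₁ - (M' : ℤ), r.2) : Face) = ((r.1 : ℤ) + ME, r.2) from Prod.ext (by simp only; omega) rfl]
              exact hWE ME hME1 le_rfl
          · rw [h0w] at hA0; have := congrArg Prod.snd hA0; simp only at this; omega
          · rw [hLS] at hsZ; exact absurd hsZ (by decide)
        · rw [show ((c₁, r.2) : Face) = ((r.1 : ℤ) + ME, r.2) from Prod.ext (by simp only; omega) rfl] at hgE
          exact hnotE hgE
      -- `e_E` turns `N` (its column carries no `S`-user) — a third top turn
      obtain ⟨jE, hjE, hfcE, hsW⟩ := hWE ME hME1 le_rfl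
      have heEN : ω.2.UsesSide ((r.1 : ℤ) + ME, r.2) .N := by
        refine ⟨jE, hjE, hfcE, ?_⟩
        have hne2 := ω.2.sIn_ne_sOut hjE
        have hnE1 : ω.2.sIn jE ≠ .E := fun e => hnotE ⟨jE, hjE, hfcE, Or.inl e⟩
        have hnE2 : ω.2.sOut jE ≠ .E := fun e => hnotE ⟨jE, hjE, hfcE, Or.inr e⟩
        have hnS1 : ω.2.sIn jE ≠ .S := by
          intro e; rcases hr2S _ ⟨jE, hjE, hfcE, Or.inl e⟩ with e' | e' | e' <;> omega
        have hnS2 : ω.2.sOut jE ≠ .S := by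
          intro e; rcases hr2S _ ⟨jE, hjE, hfcE, Or.inr e⟩ with e' | e' | e' <;> omega
        revert hsW hne2 hnE1 hnE2 hnS1 hnS2; cases ω.2.sIn jE <;> cases ω.2.sOut jE <;> decide
      obtain ⟨M', hS', -, hend'⟩ := ω.2.chain_N hY heEN
      simp only at hS' hend'
      rcases hend' with ⟨hM1, hnot⟩ | ⟨-, hs0⟩ | ⟨hZ, -⟩
      · obtain ⟨i', hi', hfc', hsv', -, -, -, hk'⟩ := ω.2.isolated_of_usesSide_not_opp (hS' M' hM1 le_rfl) hnot
        have hP' : P ((r.1 : ℤ) + ME, r.2 + M') := by rw [← hfc']; exact hPiso i' hi' hsv' hk'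
        have hrow' : ((((r.1 : ℤ) + ME, r.2 + M') : Face)).2 = Y := by
          rcases hProw _ hP' with e | e | e | e <;> simp only at e ⊢ <;> omega
        rcases htops _ hP' hrow' with e | e
        · have := congrArg Prod.fst e; simp only at this; omega
        · rw [ht₂c] at e; have := congrArg Prod.fst e; simp only at this; omega
      · exact absurd hs0 h0N
      · rw [hL] at hZ; have := congrArg Prod.fst hZ; simp only at this; omega
    revert hne hnE; cases ω.2.sOut i₁ <;> simp
  rcases houtg with hgN | hgW
  · ---------------------------------------------------------------- (a) straight up the climb column
    obtain ⟨ht₂, hrunUp, hidx⟩ := hup_to_top c₁ i₁ hi₁n hfcg' hgN (by omega)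
    obtain ⟨hTin, hMT, hrunT, hrunTin, -⟩ := htoprun c₁ ht₂ (by omega)
    have hdL' : (r.2 - Y').toNat = dL + 1 := htoNat _ _ (by push_cast; omega)
    have hdR' : (k₀ - (r.1 - MW)).toNat = dR + 1 := htoNat _ _ (by push_cast; omega)
    have hdB' : (w.2 - Y').toNat = dB + 1 := htoNat _ _ (by push_cast; omega)
    have hdM' : (r.2 - w.2).toNat = dM + 1 := htoNat _ _ (by push_cast; omega)
    have hdC' : (c₁ - k₀).toNat = dC := htoNat _ _ (by omega)
    have hdT' : (Y - r.2 - 1).toNat = dT := htoNat _ _ (by omega)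
    have hdT1 : (Y - r.2).toNat = dT + 1 := htoNat _ _ (by push_cast; omega)
    refine ⟨c₁, c₁, Y, Y', τ1, k₀, MW, ME, k₁, t₂, hY, hY', hr₃, hY'w, ht₂row, ht₂col, hτ1w, hMW1, hME1, hEW, hWW, hnotW, hWE, hEE, hnotE, hseven, hall,
      hN1, hL, hLS, hdesc, hdescIn, heWS, heWnN, hlegN, hlegS, hbWnS, hk₁F, hstr, hk₁ns, hfk, hWk, hk₀w, hbotS, hbWnW, hbEnE, hbEnS, hinF, houtF,
      hrunR, hrunL, hrunB, hrunE, hi₀n, hpass, ?_, ?_, ht₂, ?_, ?_, ?_, ?_, Or.inl ⟨rfl, ?_, ?_, ?_⟩⟩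
    · rw [hdL', hdR', hdB', hdC', hi₁'def]; exact hclimb
    · rw [hdL', hdR', hdB', hdC', hdM', hi₁'def, hi₁def]; exact hi₁n
    · rw [hdT']; exact hTin
    · rw [hdT']; exact hMT
    · rw [hdT']; exact hrunT
    · rw [hdT']; exact hrunTin
    · rw [hdL', hdR', hdB', hdC', hdM', hi₁'def, hi₁def]; exact hgN
    · rw [hdL', hdR', hdB', hdC', hdM', hi₁'def, hi₁def]; exact hrunUp
    · rw [hdL', hdR', hdB', hdC', hdM', hdT', hdT1, hi₁'def, hi₁def]; exact hidx
  · ---------------------------------------------------------------- (b) west along the row of `r` into the hook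
    have hgWu : ω.2.UsesSide (c₁, r.2) .W := ⟨_, hi₁n, hfcg', Or.inr hgW⟩
    -- `g` is singly visited: else its `N`- and `E`-sides give a top turn at `(c₁, Y)` and another one further east
    have hgnN : ¬ω.2.UsesSide (c₁, r.2) .N := by
      intro hgN
      obtain ⟨M, hSall, -, hend⟩ := ω.2.chain_N hY hgN
      simp only at hSall hend
      have ht₂c : t₂ = (c₁, Y) := by
        rcases hend with ⟨hM1, hnot⟩ | ⟨-, hs0⟩ | ⟨hZ, -⟩
        · obtain ⟨i', hi', hfc', hsv', -, -, -, hk'⟩ := ω.2.isolated_of_usesSide_not_opp (hSall M hM1 le_rfl) hnot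
          have hP' : P (c₁, r.2 + M) := by rw [← hfc']; exact hPiso i' hi' hsv' hk'
          have hrow' : (((c₁, r.2 + M) : Face)).2 = Y := by
            rcases hProw _ hP' with e | e | e | e <;> simp only at e ⊢ <;> omega
          rcases htops _ hP' hrow' with e | e
          · have := congrArg Prod.fst e; simp only at this; omega
          · simp only at hrow'; rw [← e]; exact Prod.ext rfl (by simp only; omega)
        · exact absurd hs0 h0N
        · rw [hL] at hZ; have := congrArg Prod.fst hZ; simp only at this; omega
      -- the arc using `N` is a second arc in `g`; so `g` uses `E` too
      obtain ⟨l, hl, hfl, hsN⟩ := hgN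
      have hli : l ≠ i₁ := by
        intro e
        rw [e] at hsN
        have hne2 := ω.2.sIn_ne_sOut hi₁n
        revert hsN hing hgW hne2; cases ω.2.sIn i₁ <;> cases ω.2.sOut i₁ <;> decide
      have hgE : ω.2.UsesSide (c₁, r.2) .E := hfl ▸ ω.2.usesSide_of_fc_eq hl hi₁n hli (hfl.trans hfcg'.symm) .E
      -- then `e_E` lies strictly east of `g` and turns `N`: a third top turn
      have hxE : c₁ < r.1 + ME := by
        by_contra hle
        push Not at hle
        rcases lt_or_eq_of_le hle with hlt' | heq'
        · obtain ⟨M', hEall, -, hend'⟩ := ω.2.chain_W hX hgWu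
          simp only at hEall hend'
          rcases hend' with ⟨hM1, hnot⟩ | ⟨hA0, -⟩ | ⟨-, hsZ⟩
          · obtain ⟨i', hi', hfc', hsv', -, -, -, hk'⟩ := ω.2.isolated_of_usesSide_not_opp (hEall M' hM1 le_rfl) hnot
            have hP' : P (c₁ - M', r.2) := by rw [← hfc']; exact hPiso i' hi' hsv' hk'
            rcases hmem7 _ hP' with e | e | e | e | e | e | e
            · have := congrArg Prod.snd e; simp only at this; omega
            · rw [ht₂c] at e; have := congrArg Prod.snd e; simp only at this; omega
            · have := congrArg Prod.snd e; simp only at this; omega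
            · have := congrArg Prod.snd e; simp only at this; omega
            · have := congrArg Prod.snd e; simp only at this; omega
            · have ex := congrArg Prod.fst e; simp only at ex
              obtain ⟨mm, hmm⟩ : ∃ mm : ℕ, (mm : ℤ) = c₁ - (r.1 + ME) := ⟨(c₁ - (r.1 + ME)).toNat, by omega⟩
              have := hEall mm (by omega) (by omega)
              rw [show ((c₁ - (mm : ℤ), r.2) : Face) = ((r.1 : ℤ) + ME, r.2) from Prod.ext (by simp only; omega) rfl] at this
              exact hnotE this
            · have ex := congrArg Prod.fst e; simp only at ex
              apply hnot
              rw [show ((c₁ - (M' : ℤ), r.2) : Face) = ((r.1 : ℤ) + ME, r.2) from Prod.ext (by simp only; omega) rfl]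
              exact hWE ME hME1 le_rfl
          · rw [h0w] at hA0; have := congrArg Prod.snd hA0; simp only at this; omega
          · rw [hLS] at hsZ; exact absurd hsZ (by decide)
        · rw [show ((c₁, r.2) : Face) = ((r.1 : ℤ) + ME, r.2) from Prod.ext (by simp only; omega) rfl] at hgE
          exact hnotE hgE
      obtain ⟨jE, hjE, hfcE, hsW⟩ := hWE ME hME1 le_rfl
      have heEN : ω.2.UsesSide ((r.1 : ℤ) + ME, r.2) .N := by
        refine ⟨jE, hjE, hfcE, ?_⟩
        have hne2 := ω.2.sIn_ne_sOut hjE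
        have hnE1 : ω.2.sIn jE ≠ .E := fun e => hnotE ⟨jE, hjE, hfcE, Or.inl e⟩
        have hnE2 : ω.2.sOut jE ≠ .E := fun e => hnotE ⟨jE, hjE, hfcE, Or.inr e⟩
        have hnS1 : ω.2.sIn jE ≠ .S := by
          intro e; rcases hr2S _ ⟨jE, hjE, hfcE, Or.inl e⟩ with e' | e' | e' <;> omega
        have hnS2 : ω.2.sOut jE ≠ .S := by
          intro e; rcases hr2S _ ⟨jE, hjE, hfcE, Or.inr e⟩ with e' | e' | e' <;> omega
        revert hsW hne2 hnE1 hnE2 hnS1 hnS2; cases ω.2.sIn jE <;> cases ω.2.sOut jE <;> decide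
      obtain ⟨M', hS', -, hend'⟩ := ω.2.chain_N hY heEN
      simp only at hS' hend'
      rcases hend' with ⟨hM1, hnot⟩ | ⟨-, hs0⟩ | ⟨hZ, -⟩
      · obtain ⟨i', hi', hfc', hsv', -, -, -, hk'⟩ := ω.2.isolated_of_usesSide_not_opp (hS' M' hM1 le_rfl) hnot
        have hP' : P ((r.1 : ℤ) + ME, r.2 + M') := by rw [← hfc']; exact hPiso i' hi' hsv' hk'
        have hrow' : ((((r.1 : ℤ) + ME, r.2 + M') : Face)).2 = Y := by
          rcases hProw _ hP' with e | e | e | e <;> simp only at e ⊢ <;> omega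
        rcases htops _ hP' hrow' with e | e
        · have := congrArg Prod.fst e; simp only at this; omega
        · rw [ht₂c] at e; have := congrArg Prod.fst e; simp only at this; omega
      · exact absurd hs0 h0N
      · rw [hL] at hZ; have := congrArg Prod.fst hZ; simp only at this; omega
    have hsvg : ∀ l < n, ω.2.fc l = ω.2.fc i₁ → l = i₁ :=
      fun l hl e => ω.2.single_visit_of_not_usesSide hgnN hl hi₁n (e.trans hfcg') hfcg'
    have hPg : P (c₁, r.2) := by rw [← hfcg']; exact hPiso _ hi₁n hsvg (by rw [hing, hgW]; decide)
    -- hence `g = e_E`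
    have hME : (ME : ℤ) = c₁ - r.1 := by
      rcases hmem7 _ hPg with e | e | e | e | e | e | e
      · have := congrArg Prod.snd e; simp only at this; omega
      · have := congrArg Prod.snd e; rw [ht₂row] at this; simp only at this; omega
      · have := congrArg Prod.snd e; simp only at this; omega
      · have := congrArg Prod.snd e; simp only at this; omega
      · have := congrArg Prod.snd e; simp only at this; omega
      · have := congrArg Prod.fst e; simp only at this; omega
      · have := congrArg Prod.fst e; simp only at this; omega
    -- west along the row of `r`: the plaquettes strictly between `h` and `g` are straight
    obtain ⟨dH, hdH⟩ : ∃ dH : ℕ, (dH : ℤ) = c₁ - x₁ - 1 := ⟨(c₁ - x₁ - 1).toNat, by omega⟩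
    have hrowStraight : ∀ x : ℤ, r.1 < x → x < c₁ → x ≠ x₁ → ∀ l < n, ω.2.fc l = (x, r.2) → arcKind (ω.2.sIn l) (ω.2.sOut l) = .straight := by
      intro x hx1 hx2 hx3 l hl hfl
      obtain ⟨m, hm⟩ : ∃ m : ℕ, (m : ℤ) = x - r.1 := ⟨(x - r.1).toNat, by omega⟩
      have hcE : ω.2.UsesSide (x, r.2) .E := by have := hEE m (by omega); rwa [show (r.1 : ℤ) + m = x by omega] at this
      have hcW : ω.2.UsesSide (x, r.2) .W := by have := hWE m (by omega) (by omega); rwa [show (r.1 : ℤ) + m = x by omega] at this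
      have hcS : ¬ω.2.UsesSide (x, r.2) .S := by
        intro hu; rcases hr2S _ hu with e | e | e <;> omega
      exact ω.2.straight_of_usesSide_EW hcE hcW hcS l hl hfl
    have hcellsH : ∀ m : ℕ, 1 ≤ m → m ≤ dH → ∀ l < n, ω.2.fc l = ((ω.2.fc i₁).1 - m, (ω.2.fc i₁).2) → arcKind (ω.2.sIn l) (ω.2.sOut l) = .straight := by
      intro m hm1 hmM l hl hfl
      rw [hfcg'] at hfl; exact hrowStraight _ (by simp only; omega) (by simp only; omega) (by simp only; omega) l hl hfl
    have hiH : i₁ + dH + 1 < n := by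
      by_contra hge
      have hcells' : ∀ m : ℕ, 1 ≤ m → m ≤ n - 1 - i₁ → ∀ l < n, ω.2.fc l = ((ω.2.fc i₁).1 - m, (ω.2.fc i₁).2) →
          arcKind (ω.2.sIn l) (ω.2.sOut l) = .straight := fun m hm1 hmM => hcellsH m hm1 (by omega)
      have hjM : i₁ + (n - 1 - i₁) < n := by omega
      have hidx : i₁ + (n - 1 - i₁) = n - 1 := by omega
      have hr21 : r.2 ≠ r.2 + 1 := by omega
      obtain ⟨e, -⟩ := ω.2.run_west_of_straight hjM hgW hcells' (n - 1 - i₁) le_rfl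
      rw [hidx, hL, hfcg'] at e
      exact hr21 (congrArg Prod.snd e).symm
    have hrunH := ω.2.run_west_of_straight (j := i₁) (M := dH) (by omega) hgW hcellsH
    obtain ⟨hfcH1, houtH1⟩ := hrunH dH le_rfl
    rw [hfcg'] at hfcH1
    obtain ⟨hfch, hinh⟩ := ω.2.fc_succ_eq_of_sOut_W hiH houtH1
    rw [hfcH1] at hfch; simp only at hfch
    have hfch' : ω.2.fc (i₁ + dH + 1) = (x₁, r.2) := by rw [hfch]; exact Prod.ext (by simp only; omega) rfl
    -- the hook plaquette is left through `N`
    have houth : ω.2.sOut (i₁ + dH + 1) = .N := by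
      have hne := ω.2.sIn_ne_sOut hiH
      rw [hinh] at hne
      have hnW : ω.2.sOut (i₁ + dH + 1) ≠ .W := by
        intro hW
        -- crossed straight: the run continues west into `r`
        have hhStraight : ∀ l < n, ω.2.fc l = (x₁, r.2) → arcKind (ω.2.sIn l) (ω.2.sOut l) = .straight := by
          intro l hl hfl
          have el : l = i₁ + dH + 1 := by
            by_contra hne'
            obtain ⟨hno, -⟩ := YBWalk.not_straight_of_two_arcs (γ := ω.2) (i := i₁ + dH + 1) (i' := l) hiH hl (Ne.symm hne') (hfl.trans hfch'.symm)
            rw [hinh, hW] at hno; exact hno rfl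
          subst el; rw [hinh, hW]; decide
        obtain ⟨dW, hdW⟩ : ∃ dW : ℕ, (dW : ℤ) = x₁ - r.1 - 1 := ⟨(x₁ - r.1 - 1).toNat, by omega⟩
        have hcellsW : ∀ m : ℕ, 1 ≤ m → m ≤ dH + 1 + dW → ∀ l < n, ω.2.fc l = ((ω.2.fc i₁).1 - m, (ω.2.fc i₁).2) →
            arcKind (ω.2.sIn l) (ω.2.sOut l) = .straight := by
          intro m hm1 hmM l hl hfl
          rw [hfcg'] at hfl; simp only at hfl
          by_cases hmx : (m : ℤ) = c₁ - x₁
          · exact hhStraight l hl (by rw [hfl]; exact Prod.ext (by simp only; omega) rfl)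
          · exact hrowStraight _ (by omega) (by omega) (by omega) l hl hfl
        have hiW : i₁ + (dH + 1 + dW) + 1 < n := by
          by_contra hge
          obtain ⟨e, -⟩ := ω.2.run_west_of_straight (j := i₁) (M := n - 1 - i₁) (by omega) hgW (fun m hm1 hmM l hl hfl => hcellsW m hm1 (by omega) l hl hfl)
            (n - 1 - i₁) le_rfl
          rw [show i₁ + (n - 1 - i₁) = n - 1 by omega, hL, hfcg'] at e
          have := congrArg Prod.snd e; simp only at this; omega
        obtain ⟨hfcW1, houtW1⟩ := ω.2.run_west_of_straight (j := i₁) (M := dH + 1 + dW) (by omega) hgW hcellsW (dH + 1 + dW) le_rfl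
        rw [hfcg'] at hfcW1
        obtain ⟨hfcr, -⟩ := ω.2.fc_succ_eq_of_sOut_W hiW houtW1
        rw [hfcW1] at hfcr; simp only at hfcr
        have hfcr' : ω.2.fc (i₁ + (dH + 1 + dW) + 1) = r := by rw [hfcr]; exact Prod.ext (by simp only; push_cast; omega) rfl
        have := hsvr _ hiW (hfcr'.trans hfcF.symm)
        omega
      have hnS : ω.2.sOut (i₁ + dH + 1) ≠ .S := by
        intro hS
        -- down the prefix column back into `p₁`
        have hcellsP : ∀ m : ℕ, 1 ≤ m → m ≤ dM → ∀ l < n, ω.2.fc l = ((ω.2.fc (i₁ + dH + 1)).1, (ω.2.fc (i₁ + dH + 1)).2 - m) →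
            arcKind (ω.2.sIn l) (ω.2.sOut l) = .straight := by
          intro m hm1 hmM l hl hfl
          rw [hfch'] at hfl
          exact hvert l hl (by rw [hfl]; simp only; omega) (by rw [hfl]; simp only; omega) (by rw [hfl]; simp only; omega) (by rw [hfl]; simp only; omega)
        have hiP : i₁ + dH + 1 + dM + 1 < n := by
          by_contra hge
          obtain ⟨e, -⟩ := ω.2.run_down_of_straight (j := i₁ + dH + 1) (M := n - 1 - (i₁ + dH + 1)) (by omega) hS
            (fun m hm1 hmM l hl hfl => hcellsP m hm1 (by omega) l hl hfl) (n - 1 - (i₁ + dH + 1)) le_rfl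
          rw [show i₁ + dH + 1 + (n - 1 - (i₁ + dH + 1)) = n - 1 by omega, hL, hfch'] at e
          have := congrArg Prod.fst e; simp only at this; omega
        obtain ⟨hfcP1, houtP1⟩ := ω.2.run_down_of_straight (j := i₁ + dH + 1) (M := dM) (by omega) hS hcellsP dM le_rfl
        rw [hfch'] at hfcP1
        have hfcp := ω.2.fc_succ_eq_of_sOut_S hiP houtP1
        have hinp := sIn_succ_eq_N ω.2 hiP houtP1
        rw [hfcP1] at hfcp; simp only at hfcp
        have hfcp' : ω.2.fc (i₁ + dH + 1 + dM + 1) = ω.2.fc k₁ := by rw [hfcp, hfk]; exact Prod.ext rfl (by simp only; omega)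
        obtain ⟨-, -, h2, -, -⟩ := YBWalk.not_straight_of_two_arcs (γ := ω.2) (i := k₁) (i' := i₁ + dH + 1 + dM + 1) (by omega) hiP (by omega) hfcp'
        -- `p₁` turns `N` in case (I); in case (II) it is singly visited
        rcases hpass with ⟨-, -, -, hk₁N, -⟩ | ⟨-, -, -, hp₁nS, -⟩
        · rw [hinp, hk₁N] at h2; exact h2 rfl
        · have := ω.2.single_visit_of_not_usesSide hp₁nS hiP (show k₁ < n by omega) (by rw [hfcp', hfk]) hfk
          omega
      revert hne hnW hnS; cases ω.2.sOut (i₁ + dH + 1) <;> decide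
    -- up the prefix column to the top turn `t₂ = (x₁, Y)`, then the top row into `T`
    obtain ⟨ht₂, hrunUp, hidx⟩ := hup_to_top x₁ (i₁ + dH + 1) hiH hfch' houth (by omega)
    obtain ⟨hTin, hMT, hrunT, hrunTin, -⟩ := htoprun x₁ ht₂ (by omega)
    have hdL' : (r.2 - Y').toNat = dL + 1 := htoNat _ _ (by push_cast; omega)
    have hdR' : (k₀ - (r.1 - MW)).toNat = dR + 1 := htoNat _ _ (by push_cast; omega)
    have hdB' : (w.2 - Y').toNat = dB + 1 := htoNat _ _ (by push_cast; omega)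
    have hdM' : (r.2 - w.2).toNat = dM + 1 := htoNat _ _ (by push_cast; omega)
    have hdC' : (c₁ - k₀).toNat = dC := htoNat _ _ (by omega)
    have hdT' : (Y - r.2 - 1).toNat = dT := htoNat _ _ (by omega)
    have hdT1 : (Y - r.2).toNat = dT + 1 := htoNat _ _ (by push_cast; omega)
    have hdH' : (c₁ - (w.1 + (k₁ : ℤ))).toNat = dH + 1 := htoNat _ _ (by push_cast; omega)
    refine ⟨x₁, c₁, Y, Y', τ1, k₀, MW, ME, k₁, t₂, hY, hY', hr₃, hY'w, ht₂row, ht₂col, hτ1w, hMW1, hME1, hEW, hWW, hnotW, hWE, hEE, hnotE, hseven, hall,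
      hN1, hL, hLS, hdesc, hdescIn, heWS, heWnN, hlegN, hlegS, hbWnS, hk₁F, hstr, hk₁ns, hfk, hWk, hk₀w, hbotS, hbWnW, hbEnE, hbEnS, hinF, houtF,
      hrunR, hrunL, hrunB, ?_, ?_, ?_, ?_, ?_, ht₂, ?_, ?_, ?_, ?_, Or.inr ⟨rfl, hME, ?_, ?_, ?_, ?_, ?_⟩⟩
    · exact hrunE
    · exact hi₀n
    · exact hpass
    · rw [hdL', hdR', hdB', hdC', hi₁'def]; exact hclimb
    · rw [hdL', hdR', hdB', hdC', hdM', hi₁'def, hi₁def]; exact hi₁n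
    · rw [hdT']; exact hTin
    · rw [hdT']; exact hMT
    · rw [hdT']; exact hrunT
    · rw [hdT']; exact hrunTin
    · rw [hdL', hdR', hdB', hdC', hdM', hi₁'def, hi₁def]; exact hgW
    · intro m hm1 hmM
      rw [hdL', hdR', hdB', hdC', hdM', hi₁'def, hi₁def]
      clear hdL' hdR' hdB' hdC' hdM' hdT' hdT1 hdH'
      rcases Nat.lt_or_ge dH m with hbig | hsmall
      · have em : m = dH + 1 := by omega
        subst em
        rw [show i₁ + (dH + 1) = i₁ + dH + 1 from rfl]
        exact ⟨by rw [hfch']; exact Prod.ext (by simp only; push_cast; omega) rfl, hinh⟩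
      · rcases Nat.eq_zero_or_pos m with h0 | hpos
        · omega
        obtain ⟨e1, e1o⟩ := hrunH (m - 1) (by omega)
        have hjm : i₁ + (m - 1) + 1 < n := by omega
        obtain ⟨e2, e3⟩ := ω.2.fc_succ_eq_of_sOut_W hjm e1o
        rw [e1, hfcg'] at e2; simp only at e2
        rw [show i₁ + (m - 1) + 1 = i₁ + m by omega] at e2 e3
        exact ⟨by rw [e2]; exact Prod.ext (by simp only; push_cast [Nat.cast_sub hpos]; omega) rfl, e3⟩
    · rw [hdL', hdR', hdB', hdC', hdM', hdH', hi₁'def, hi₁def, show i₁ + (dH + 1) = i₁ + dH + 1 from rfl]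
      exact houth
    · intro m hm1 hmM
      rw [hdL', hdR', hdB', hdC', hdM', hdH', hi₁'def, hi₁def, show i₁ + (dH + 1) = i₁ + dH + 1 from rfl]
      exact hrunUp m hm1 hmM
    · rw [hdL', hdR', hdB', hdC', hdM', hdH', hdT', hdT1, hi₁'def, hi₁def, show i₁ + (dH + 1) = i₁ + dH + 1 from rfl]
      exact hidx

end ΩG

end Literature.Probability.RandomPlanarGeometry.SAW.YangBaxter
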